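import Literature.Barriers.RiemannHypothesis.FeketePolyaPositivityProofs
import HarnessLib

/-!
# Heilbronn's form of the Fekete–Pólya barrier: every real character that mimics Liouville's `λ` on `1 … 12` fails at every order; Louboutin's `L(1, χ) ≥ 1/2` constraint on Chowla's evasion; the theta kernel at `d = −163`

Barrier-audit sibling (D-0021, audit of 2026-08-16) of
`Literature/Barriers/RiemannHypothesis/FeketePolyaPositivity.lean` (catalogue entry
`FeketePolyaPositivity`: "`P(7/10, χ_{−163}) < 0`, hence for every `k` some `S_k(N, χ_{−163}) < 0`",
MV §11.2.1 Exercise 7 (k)) and of `FeketePolyaPositivityProofs.lean` (the order-one criterion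
`LFunction_re_pos_of_summatory_nonneg` and MV Exercise 8). Everything here is PROVED; the file
declares no definitions. It widens the catalogued obstruction from the single character
`χ_{−163}` to the positive-density family of Heilbronn's 1937 note, records the quantitative
constraint the technique puts on `L(1, χ)` (Louboutin 2003) — hence on the inducing modulus of
Chowla's evasion — and shows that the second classical positive Mellin kernel, the theta series,
fails at `d = −163` as well.

## 1. Heilbronn (1937): Liouville mimicry kills every order

Heilbronn, *On real characters* (Acta Arith. 2 (1937), 212–213; read in *The Collected Papers of
H. A. Heilbronn*, Wiley 1988, paper [17]): with `f(y) = ∑ λ(n) e^{−ny}` (`λ` = Liouville's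
function), "`Γ(s) ζ(2s)/ζ(s) = ∫_0^∞ y^{s−1} f(y) dy` for `s > 1`, and the integral tends to `0` as
`s → 1`. Hence, `f(y)` not being identically `0`, `f(y) < 0` for some suitably chosen `y > 0`. We
choose an integer `a > 0` such that (2) `f(y) + 2 ∑_{n > a} e^{−ny} < 0` and an integer `d` … such
that `(d/p) = −1` for all primes `p ≤ a`. … Then `χ(n) = (d/n) = λ(n)` for `n ≤ a`, and by (2),
(3) `∑ χ(n) e^{−ny} ≤ f(y) + 2 ∑_{n > a} e^{−ny} < 0`. As `∑ χ(n) e^{−ny} = (1 − e^{−y})^m ∑ S_m(n) e^{−ny}`,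
(3) shews that (1) [`S_m(x) ≥ 0` for `x ≥ 1`] is not true for any value of `m`." (Cassels–Fröhlich,
ibid., memoir: "Paper 16 … neatly disproves a conjecture of Chowla about iterated character sums".)

Montgomery–Vaughan's numerics for Exercise 7 (k) — `∑_{n ≤ 12} (n/163)(7/10)ⁿ = −0.0483…`,
`∑_{n ≥ 13} (7/10)ⁿ = 0.0323…` — are exactly Heilbronn's (2)–(3) with `e^{−y} = 7/10`, `a = 12`
and the sharper tail `∑_{n > a} e^{−ny}` (valid because `|χ| ≤ 1`), and they use of `χ_{−163}`
only that `(n/163) = λ(n)` for `n ≤ 12`, i.e. that `2, 3, 5, 7, 11` are inert in `ℚ(√−163)`. So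
the tree's proof of `iterSummatory_chi163_neg` proves verbatim:

* `powerSeries_neg_of_liouville`, `iterSummatory_neg_of_liouville` — for EVERY real sequence `f`
  with `f(0) = 0`, `|f| ≤ 1` and `f(n) = λ(n) = (−1)^{Ω(n)}` for `1 ≤ n ≤ 12`:
  `∑ f(n) (7/10)ⁿ < 0`, and for every `k` there is `N ≥ 1` with `S_k(N) < 0`;
* `feketePolya_hypothesis_fails_of_apply_primes` — for EVERY Dirichlet character `χ` (any
  modulus, any parity, primitive or not) with `χ(2) = χ(3) = χ(5) = χ(7) = χ(11) = −1`, the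
  Fekete–Pólya hypothesis `S_k(N, χ) ≥ 0 ∀ N ≥ 1` fails at every order `k` (and the envelope
  `P(7/10, χ) < 0`, `powerSeries_re_neg_of_apply_primes`). For quadratic characters
  `χ_d = (d/·)` the condition is a congruence condition on `d` modulo `8·3·5·7·11`, of relative
  density about `2^{−5}` among fundamental discriminants of either sign;
* instances: `χ_{−163}` (`chi163Char_apply_primes`: the landed `feketePolya_hypothesis_fails_chi163`
  is the case `χ = chi163Char`), the odd `χ_{−67}`
  (`ℚ(√−67)`, class number one; CGPS list "`p = 43, 67, 163, …`") and the EVEN `χ_{173} = (·/173)`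
  (a real quadratic field) — `feketePolya_hypothesis_fails_67`, `feketePolya_hypothesis_fails_173`.

Literature status of the scope (not formalised): `m(χ) := min {k : S_k(·, χ) ≥ 0}` is finite iff
`P(t, χ) > 0` on `(0, 1)` [cite: Louboutin2013Chowla, Proposition 1.1] (Bateman–Purdy–Wagstaff
1975, Lemma 6); `m(χ_D) = ∞` for almost all fundamental discriminants `D` (Baker–Montgomery 1990,
"[BM, Corollary]": "the set of real non-principal characters `χ` for which `m(χ) < ∞` has
asymptotic density `0`" [cite: Louboutin2013Chowla, p. 79]); only 23 primes `p < 1000` have a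
Fekete polynomial with a zero in `(0, 1)` [cite: ConreyGranvillePoonenSound2000, §1]; for all but
`O(x exp(−(log₃ x)^A))` fundamental `0 < D ≤ x` the Fekete polynomial has `≫ log₂ D / log₄ D`
zeros in `(1 − e^{−(log D)^{α/100}}, 1 − e^{−(log D)^α})` [cite: KlurmanLamzouriMunsch2024, Theorem 1.2],
and the proportion of `|D| ≤ x` with `S_{χ_D}(N) ≥ 0` for all `N` is `≪ exp(−c log₂ x / log₃ x)`
[cite: KlurmanLamzouriMunsch2024, Corollary 1.5].

## 2. Louboutin (2003): the technique needs `L(1, χ) ≥ 1/2` (order 1), `> 1 − log 2` (any order)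

"Proposition 3. Let `χ` be a real non-principal Dirichlet character. If `S_χ^{(m)}(n) ≥ 0` for
all `n ≥ 1`, then `L(1, χ) ≥ 1 − ∑_{n=1}^{m} 1/(n+m) > 1 − log 2 = 0.306852…`" and "Theorem 1.
If `L(1, χ) ≤ 1 − log 2` then `m(χ) = ∞`", for `χ` primitive OR NOT [cite: Louboutin2003, p. 208].
Here the case `m = 1` is proved for Mathlib's `LFunction` (`half_le_re_LFunction_one_of_summatory_nonneg`:
`S_1 ≥ 0 ⇒ Re L(1, χ) ≥ 1/2`, indeed `Re L(σ, χ) ≥ 1 − 2^{−σ}` for `σ > 0`,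
`one_sub_two_rpow_le_re_LFunction_of_summatory_nonneg`), with its consequence for Chowla's
induced-character evasion (`ChowlaInducedCharacterConjectureOdd`, sibling file
`FeketePolyaPositivityChowla.lean`): an inducing modulus `q` with `S_1(·, ψ↑q) ≥ 0` must satisfy
`Re L(1, ψ) · ∏_{p ∣ q} (1 − ψ(p)/p) ≥ 1/2` (`half_le_re_LFunction_one_mul_eulerFactors_of_induced`).
For `ψ = χ_{−163}` (`L(1, ψ) = π/√163 = 0.246…`) this alone forces `∏_{p ∣ q}(1 + 1/p) ≥ 2.03`
over inert `p ∣ q`; the sibling `FeketePolyaPositivityChowla163.lean` proves the much stronger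
arithmetic constraint `q ≥ 6.5 · 10^{12}`, matching Louboutin's report that the induced-character
hypothesis is computationally unverified at `163` [cite: Louboutin2013Chowla, §7].

## 3. The theta kernel also fails at `d = −163`

For an odd primitive real `χ` mod `q` the completed `L`-function is a Mellin transform of the
theta series `θ₁(t, χ) = ∑_{n ≥ 1} n χ(n) e^{−π n² t/q}` (Davenport, *Multiplicative Number Theory*,
Ch. 9), so `θ₁(·, χ) > 0` on `(0, ∞)` would give `L(σ, χ) > 0` on `(0, 1)` exactly as `P(·, χ) > 0`
on `(0, 1)` does — the other classical "positive Mellin kernel" of the catalogue's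
`technique_class`. At `t₀ = (163/π) log(50/49) = 1.048…` every term of `θ₁(t₀, χ_{−163})` is the
rational number `n (n/163) (49/50)^{n²}`, and `θ₁(t₀, χ_{−163}) ≤ −3.9 + 2.5 < 0`
(`theta_chi163_neg`, `thetaKernel_chi163_neg`: head `n ≤ 30` by `norm_num`, tail by
`∑ n rⁿ = r/(1 − r)²` with `r = (49/50)^{31}`). Numerically `θ₁(t, χ_{−163}) < 0` for
`0.09 < t < 11` (e.g. `θ₁(1) = −4.06`); generically, `θ(·, χ_D)` has `≫ log₂ D/ log₄ D` real zeros
for almost all `D` [cite: KlurmanLamzouriMunsch2024, Corollary 1.9]. The Mellin identity itself is not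
formalised here; the theorem is the sign of the series.

## References

* [Heilbronn1937RealCharacters] H. Heilbronn, *On real characters*, Acta Arith. 2 (1937), 212–213
  (read in: *The Collected Papers of Hans Arnold Heilbronn*, E. J. Kani, R. A. Smith eds., Wiley
  1988, paper [17]; quoted above).
* [MontgomeryVaughan2007] H. L. Montgomery, R. C. Vaughan, *Multiplicative Number Theory I*, CUP
  2007, §11.2.1 Exercise 7 (k) (PDF p. 288 of the held copy).
* [Louboutin2003] S. R. Louboutin, Colloq. Math. 96 (2003), 207–212 (read; Prop. 3 and Thm. 1, p. 208).
* [Louboutin2013Chowla] S. Louboutin, *On the size of `L(1,χ)` and S. Chowla's hypothesis implying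
  that `L(1,χ) > 0` for `s > 0` and for real characters `χ`*, Colloq. Math. 130 (2013), 79–90
  (read; Prop. 1.1 p. 80, p. 79, §§6–7 pp. 87–89).
* [ConreyGranvillePoonenSound2000] B. Conrey, A. Granville, B. Poonen, K. Soundararajan, *Zeros of
  Fekete polynomials*, Ann. Inst. Fourier 50 (2000), 865–889 (read: §1, arXiv:math/9906214).
* [KlurmanLamzouriMunsch2024] O. Klurman, Y. Lamzouri, M. Munsch, *Sign changes of short character
  sums and real zeros of Fekete polynomials*, arXiv:2403.02195 (read: Thm. 1.2, Cor. 1.5, Cor. 1.9).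
* [BakerMontgomery1990] R. C. Baker, H. L. Montgomery, *Oscillations of quadratic `L`-functions*, in:
  Analytic Number Theory (Allerton Park 1989), Progr. Math. 85, Birkhäuser 1990, 23–40 (cited
  through [Louboutin2013Chowla, p. 79] and [KlurmanLamzouriMunsch2024, §1.1]; not read).

## Design notes

* `λ(n)` is written `(−1)^{Ω(n)}` with Mathlib's `ArithmeticFunction.cardFactors` (`Ω`); the
  hypothesis "`f = λ` on `1 … 12`" is `∀ n, 1 ≤ n → n ≤ 12 → f n = (−1) ^ Ω n`.
* Characters are Mathlib's `DirichletCharacter ℂ q`; "`χ(p) = −1`" is `χ (p : ZMod q) = −1`;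
  `S_k` is `iterSummatory (fun n ↦ (χ n).re) k` as in the sibling files; the quadratic characters
  mod the primes `67`, `173` are written inline as `(quadraticChar (ZMod p)).ringHomComp (Int.castRingHom ℂ)`
  (no new definitions; the primality of the modulus enters as an instance hypothesis
  `[Fact (Nat.Prime p)]`, dischargeable by `norm_num`), their values being Legendre symbols
  (`quadraticCharComplex_apply_natCast`, evaluated by `norm_num`).
-/

noncomputable section

open Complex Finset Filter Topology ArithmeticFunction

open scoped ArithmeticFunction.Omega

namespace Literature.Barriers.RiemannHypothesis

/-! ## Liouville's function on `1 … 12` -/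

/-- The twelve values `λ(1), …, λ(12) = 1, −1, −1, 1, −1, 1, −1, −1, 1, 1, −1, −1` of Liouville's
function `λ(n) = (−1)^{Ω(n)}`, transported to any `f` that agrees with `λ` on `1 … 12`. [folklore] -/
theorem values_of_eq_liouville (f : ℕ → ℝ) (hlam : ∀ n, 1 ≤ n → n ≤ 12 → f n = (-1) ^ Ω n) :
    f 1 = 1 ∧ f 2 = -1 ∧ f 3 = -1 ∧ f 4 = 1 ∧ f 5 = -1 ∧ f 6 = 1 ∧ f 7 = -1 ∧ f 8 = -1 ∧
      f 9 = 1 ∧ f 10 = 1 ∧ f 11 = -1 ∧ f 12 = -1 := by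
  refine ⟨?_, ?_, ?_, ?_, ?_, ?_, ?_, ?_, ?_, ?_, ?_, ?_⟩ <;>
    (rw [hlam _ (by norm_num) (by norm_num), cardFactors_apply]; norm_num [Nat.primeFactorsList])

/-! ## MV Exercise 11.2.1.7 (k) for every Liouville-mimicking sequence (Heilbronn 1937) -/

/-- "`∑_{n=1}^{12} (n/163)(7/10)ⁿ = −0.0483`" holds for every `f` with `f(0) = 0` that agrees with
`λ` on `1 … 12`: the sum is exactly `−48336732731/10¹²`.
[cite: MontgomeryVaughan2007, §11.2.1 Exercise 7 (k)] [cite: Heilbronn1937RealCharacters] -/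
theorem sum_range_13_of_eq_liouville (f : ℕ → ℝ) (hf0 : f 0 = 0)
    (hlam : ∀ n, 1 ≤ n → n ≤ 12 → f n = (-1) ^ Ω n) :
    ∑ n ∈ range 13, f n * (7 / 10 : ℝ) ^ n = -48336732731 / 10 ^ 12 := by
  obtain ⟨h1, h2, h3, h4, h5, h6, h7, h8, h9, h10, h11, h12⟩ := values_of_eq_liouville f hlam
  simp only [Finset.sum_range_succ, Finset.sum_range_zero, hf0, h1, h2, h3, h4, h5, h6, h7, h8, h9,
    h10, h11, h12]
  norm_num

/-- **Heilbronn 1937, (3), in MV's numerics**: if `f(0) = 0`, `|f| ≤ 1` and `f(n) = λ(n)` for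
`1 ≤ n ≤ 12`, then `∑ f(n)(7/10)ⁿ ≤ −0.0483… + ∑_{n ≥ 13}(7/10)ⁿ = −0.0483… + 0.0323… < 0`
("`∑ χ(n) e^{−ny} ≤ f(y) + 2∑_{n > a} e^{−ny} < 0`", here with the sharper tail allowed by
`|f| ≤ 1`). [cite: Heilbronn1937RealCharacters] [cite: MontgomeryVaughan2007, §11.2.1 Exercise 7 (k)] -/
theorem powerSeries_neg_of_eq_liouville (f : ℕ → ℝ) (hf0 : f 0 = 0) (hf : ∀ n, |f n| ≤ 1)
    (hlam : ∀ n, 1 ≤ n → n ≤ 12 → f n = (-1) ^ Ω n) :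
    ∑' n : ℕ, f n * (7 / 10 : ℝ) ^ n < 0 := by
  have hz0 : (0 : ℝ) ≤ 7 / 10 := by norm_num
  have hz1 : (7 / 10 : ℝ) < 1 := by norm_num
  have hs : Summable fun n : ℕ ↦ f n * (7 / 10 : ℝ) ^ n :=
    (summable_norm_iterSummatory_mul_pow f hf 0 hz0 hz1).of_norm
  rw [← hs.sum_add_tsum_nat_add 13, sum_range_13_of_eq_liouville f hf0 hlam]
  have htail : ∑' n : ℕ, f (n + 13) * (7 / 10 : ℝ) ^ (n + 13) ≤
      ∑' n : ℕ, (7 / 10 : ℝ) ^ 13 * (7 / 10) ^ n := by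
    refine Summable.tsum_le_tsum (fun n ↦ ?_) ((summable_nat_add_iff 13).2 hs)
      ((summable_geometric_of_lt_one hz0 hz1).mul_left _)
    rw [pow_add, mul_comm ((7 / 10 : ℝ) ^ n), ← mul_assoc]
    refine mul_le_mul_of_nonneg_right ?_ (pow_nonneg hz0 n)
    calc f (n + 13) * (7 / 10 : ℝ) ^ 13 ≤ 1 * (7 / 10) ^ 13 :=
          mul_le_mul_of_nonneg_right (le_of_abs_le (hf _)) (pow_nonneg hz0 13)
      _ = (7 / 10) ^ 13 := one_mul _
  rw [tsum_mul_left, tsum_geometric_of_lt_one hz0 hz1] at htail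
  have : (-48336732731 / 10 ^ 12 : ℝ) + (7 / 10 : ℝ) ^ 13 * (1 - 7 / 10)⁻¹ < 0 := by norm_num
  linarith

/-- **Heilbronn 1937: Liouville mimicry on `1 … 12` kills the Fekete–Pólya hypothesis at every
order.** If `f(0) = 0`, `|f| ≤ 1` and `f(n) = λ(n)` for `1 ≤ n ≤ 12`, then for every `k` there is
`N ≥ 1` with `S_k(N) < 0` ("(3) shews that (1) is not true for any value of `m`"; via MV (i)–(j):
`∑ S_k(n) zⁿ = P(z)(1 − z)^{−k}` and `P(7/10) < 0`). The tree's `iterSummatory_chi163_neg` is the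
case `f = χ_{−163}`. [cite: Heilbronn1937RealCharacters] [cite: MontgomeryVaughan2007, §11.2.1 Exercise 7 (k)] -/
theorem iterSummatory_neg_of_eq_liouville (f : ℕ → ℝ) (hf0 : f 0 = 0) (hf : ∀ n, |f n| ≤ 1)
    (hlam : ∀ n, 1 ≤ n → n ≤ 12 → f n = (-1) ^ Ω n) (k : ℕ) :
    ∃ N : ℕ, 1 ≤ N ∧ iterSummatory f k N < 0 := by
  by_contra! h
  have := tsum_nonneg_of_iterSummatory_nonneg f hf0 hf k h (z := 7 / 10) (by norm_num) (by norm_num)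
  exact absurd (powerSeries_neg_of_eq_liouville f hf0 hf hlam) (not_lt.2 this)

/-! ## Dirichlet characters with `χ(p) = −1` for `p = 2, 3, 5, 7, 11` -/

/-- `|Re χ(n)| ≤ 1` for a Dirichlet character with complex values. [folklore] -/
theorem abs_re_apply_le_one {q : ℕ} (χ : DirichletCharacter ℂ q) (a : ZMod q) : |(χ a).re| ≤ 1 :=
  (Complex.abs_re_le_norm _).trans (χ.norm_le_one a)

/-- A character taking the value `−1` somewhere has modulus `q ≥ 2`, so `χ(0) = 0`. [folklore] -/
theorem re_apply_zero_of_apply_eq_neg_one {q : ℕ} [NeZero q] (χ : DirichletCharacter ℂ q)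
    {a : ZMod q} (ha : χ a = -1) : (χ ((0 : ℕ) : ZMod q)).re = 0 := by
  rcases Nat.lt_or_ge 1 q with hq | hq
  · haveI : Fact (1 < q) := ⟨hq⟩
    simp [MulChar.map_zero]
  · have hq1 : q = 1 := le_antisymm hq NeZero.one_le
    subst hq1
    have h1 : χ a = 1 := by rw [χ.level_one]; exact MulChar.one_apply (isUnit_of_subsingleton a)
    rw [h1] at ha
    norm_num at ha

/-- If `χ(2) = χ(3) = χ(5) = χ(7) = χ(11) = −1` then `Re χ(n) = λ(n)` for `1 ≤ n ≤ 12` (complete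
multiplicativity: `χ(4) = χ(2)² = 1`, `χ(6) = 1`, `χ(8) = −1`, `χ(9) = 1`, `χ(10) = 1`,
`χ(12) = −1`). For `χ = (d/·)` this is Heilbronn's choice "`(d/p) = −1` for all primes `p ≤ a`"
with `a = 12`. [cite: Heilbronn1937RealCharacters] -/
theorem re_apply_eq_liouville_of_apply_primes {q : ℕ} [NeZero q] (χ : DirichletCharacter ℂ q)
    (h2 : χ (2 : ZMod q) = -1) (h3 : χ (3 : ZMod q) = -1) (h5 : χ (5 : ZMod q) = -1)
    (h7 : χ (7 : ZMod q) = -1) (h11 : χ (11 : ZMod q) = -1) :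
    ∀ n : ℕ, 1 ≤ n → n ≤ 12 → (χ (n : ZMod q)).re = (-1) ^ Ω n := by
  intro n hn1 hn12
  interval_cases n
  · simp
  · rw [Nat.cast_ofNat, h2, cardFactors_apply_prime Nat.prime_two]; norm_num
  · rw [Nat.cast_ofNat, h3, cardFactors_apply_prime Nat.prime_three]; norm_num
  · rw [show ((4 : ℕ) : ZMod q) = 2 * 2 by norm_num, map_mul, h2, cardFactors_apply]
    norm_num [Nat.primeFactorsList]
  · rw [Nat.cast_ofNat, h5, cardFactors_apply_prime Nat.prime_five]; norm_num
  · rw [show ((6 : ℕ) : ZMod q) = 2 * 3 by norm_num, map_mul, h2, h3, cardFactors_apply]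
    norm_num [Nat.primeFactorsList]
  · rw [Nat.cast_ofNat, h7, cardFactors_apply_prime (by norm_num)]; norm_num
  · rw [show ((8 : ℕ) : ZMod q) = 2 * 2 * 2 by norm_num, map_mul, map_mul, h2, cardFactors_apply]
    norm_num [Nat.primeFactorsList]
  · rw [show ((9 : ℕ) : ZMod q) = 3 * 3 by norm_num, map_mul, h3, cardFactors_apply]
    norm_num [Nat.primeFactorsList]
  · rw [show ((10 : ℕ) : ZMod q) = 2 * 5 by norm_num, map_mul, h2, h5, cardFactors_apply]
    norm_num [Nat.primeFactorsList]
  · rw [Nat.cast_ofNat, h11, cardFactors_apply_prime (by norm_num)]; norm_num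
  · rw [show ((12 : ℕ) : ZMod q) = 2 * 2 * 3 by norm_num, map_mul, map_mul, h2, h3,
      cardFactors_apply]
    norm_num [Nat.primeFactorsList]

/-- **The envelope fails**: `P(7/10, χ) = ∑ Re χ(n) (7/10)ⁿ < 0` for every Dirichlet character
with `χ(2) = χ(3) = χ(5) = χ(7) = χ(11) = −1` (any modulus, any parity, primitive or not).
[cite: Heilbronn1937RealCharacters] [cite: MontgomeryVaughan2007, §11.2.1 Exercise 7 (k)] -/
theorem powerSeries_re_neg_of_apply_primes {q : ℕ} [NeZero q] (χ : DirichletCharacter ℂ q)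
    (h2 : χ (2 : ZMod q) = -1) (h3 : χ (3 : ZMod q) = -1) (h5 : χ (5 : ZMod q) = -1)
    (h7 : χ (7 : ZMod q) = -1) (h11 : χ (11 : ZMod q) = -1) :
    ∑' n : ℕ, (χ (n : ZMod q)).re * (7 / 10 : ℝ) ^ n < 0 :=
  powerSeries_neg_of_eq_liouville (fun n ↦ (χ (n : ZMod q)).re)
    (re_apply_zero_of_apply_eq_neg_one χ h2) (fun _ ↦ abs_re_apply_le_one χ _)
    (re_apply_eq_liouville_of_apply_primes χ h2 h3 h5 h7 h11)

/-- **Heilbronn's form of the barrier.** For every Dirichlet character `χ` with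
`χ(2) = χ(3) = χ(5) = χ(7) = χ(11) = −1` — any modulus, either parity, primitive or induced — and
every order `k`, the Fekete–Pólya hypothesis "`S_k(N, χ) ≥ 0` for all `N ≥ 1`" fails; so neither
the named fact `FeketePolya1912` (any `k`) nor its envelope `P(z, χ) > 0` can be invoked for any
such `χ`. For `χ = χ_d` these are the `d` with `(d/p) = −1` for `p ≤ 11`, a set of fundamental
discriminants of positive density containing `−67`, `−163`, `173`, … ("It will be shewn in this
paper that this [`S_m(x) ≥ 0` for `m ≥ m₀(χ)`] is not the case for all real characters").
[cite: Heilbronn1937RealCharacters] [cite: MontgomeryVaughan2007, §11.2.1 Exercise 7 (k)] -/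
theorem feketePolya_hypothesis_fails_of_apply_primes {q : ℕ} [NeZero q]
    (χ : DirichletCharacter ℂ q) (h2 : χ (2 : ZMod q) = -1) (h3 : χ (3 : ZMod q) = -1)
    (h5 : χ (5 : ZMod q) = -1) (h7 : χ (7 : ZMod q) = -1) (h11 : χ (11 : ZMod q) = -1) (k : ℕ) :
    ¬ ∀ N : ℕ, 1 ≤ N → 0 ≤ iterSummatory (fun n ↦ (χ (n : ZMod q)).re) k N := by
  intro h
  obtain ⟨N, hN, hneg⟩ := iterSummatory_neg_of_eq_liouville (fun n ↦ (χ (n : ZMod q)).re)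
    (re_apply_zero_of_apply_eq_neg_one χ h2) (fun _ ↦ abs_re_apply_le_one χ _)
    (re_apply_eq_liouville_of_apply_primes χ h2 h3 h5 h7 h11) k
  exact absurd (h N hN) (not_le.2 hneg)

/-! ## Instances: `d = −163` recovered, `d = −67` (odd), `d = 173` (even) -/

/-- The quadratic character of the prime field `ZMod p`, with complex values, is the Legendre
symbol: `χ_p(n) = (n/p)`. [folklore] -/
theorem quadraticCharComplex_apply_natCast (p : ℕ) [Fact p.Prime] (n : ℕ) :
    ((quadraticChar (ZMod p)).ringHomComp (Int.castRingHom ℂ)) (n : ZMod p) =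
      ((jacobiSym n p : ℤ) : ℂ) := by
  rw [← jacobiSym.legendreSym.to_jacobiSym]
  simp [MulChar.ringHomComp_apply, legendreSym]

/-- `χ_{−163}(p) = −1` for `p = 2, 3, 5, 7, 11` (indeed for all `p ≤ 37`: Euler's polynomial
`n² + n + 41`), so the landed `feketePolya_hypothesis_fails_chi163` is the instance
`feketePolya_hypothesis_fails_of_apply_primes chi163Char` of Heilbronn's theorem. [folklore] -/
theorem chi163Char_apply_primes :
    chi163Char (2 : ZMod 163) = -1 ∧ chi163Char (3 : ZMod 163) = -1 ∧
      chi163Char (5 : ZMod 163) = -1 ∧ chi163Char (7 : ZMod 163) = -1 ∧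
        chi163Char (11 : ZMod 163) = -1 := by
  refine ⟨?_, ?_, ?_, ?_, ?_⟩
  · rw [show (2 : ZMod 163) = ((2 : ℕ) : ZMod 163) from rfl, chi163Char_apply_natCast, chi163]
    norm_num
  · rw [show (3 : ZMod 163) = ((3 : ℕ) : ZMod 163) from rfl, chi163Char_apply_natCast, chi163]
    norm_num
  · rw [show (5 : ZMod 163) = ((5 : ℕ) : ZMod 163) from rfl, chi163Char_apply_natCast, chi163]
    norm_num
  · rw [show (7 : ZMod 163) = ((7 : ℕ) : ZMod 163) from rfl, chi163Char_apply_natCast, chi163]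
    norm_num
  · rw [show (11 : ZMod 163) = ((11 : ℕ) : ZMod 163) from rfl, chi163Char_apply_natCast, chi163]
    norm_num

/-- **`d = −67`**: the odd quadratic character `(·/67)` of `ℚ(√−67)` (class number one; `2, 3, 5,
7, 11, 13` inert) fails the Fekete–Pólya hypothesis at every order ("for example `p = 43, 67,
163, …`"). The instance hypothesis `Fact (Nat.Prime 67)` (needed to form `quadraticChar (ZMod 67)`)
is discharged by `⟨by norm_num⟩`. [cite: ConreyGranvillePoonenSound2000, §1] [cite: Heilbronn1937RealCharacters] -/
theorem feketePolya_hypothesis_fails_67 [Fact (Nat.Prime 67)] (k : ℕ) :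
    ¬ ∀ N : ℕ, 1 ≤ N → 0 ≤ iterSummatory (fun n ↦
      ((quadraticChar (ZMod 67)).ringHomComp (Int.castRingHom ℂ) (n : ZMod 67)).re) k N := by
  refine feketePolya_hypothesis_fails_of_apply_primes _ ?_ ?_ ?_ ?_ ?_ k
  · rw [show (2 : ZMod 67) = ((2 : ℕ) : ZMod 67) from rfl, quadraticCharComplex_apply_natCast]
    norm_num
  · rw [show (3 : ZMod 67) = ((3 : ℕ) : ZMod 67) from rfl, quadraticCharComplex_apply_natCast]
    norm_num
  · rw [show (5 : ZMod 67) = ((5 : ℕ) : ZMod 67) from rfl, quadraticCharComplex_apply_natCast]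
    norm_num
  · rw [show (7 : ZMod 67) = ((7 : ℕ) : ZMod 67) from rfl, quadraticCharComplex_apply_natCast]
    norm_num
  · rw [show (11 : ZMod 67) = ((11 : ℕ) : ZMod 67) from rfl, quadraticCharComplex_apply_natCast]
    norm_num

/-- **`d = 173`, an EVEN character**: `(·/173)` (the character of the real quadratic field
`ℚ(√173)`; `173 ≡ 5 (mod 8)`, and `3, 5, 7, 11` are non-residues) fails the Fekete–Pólya
hypothesis at every order `k` — in particular at the order `k = 2` used for even characters in
`FeketePolyaPositivityChowla.lean` (`Fact (Nat.Prime 173)` is discharged by `⟨by norm_num⟩`).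
[cite: Heilbronn1937RealCharacters] -/
theorem feketePolya_hypothesis_fails_173 [Fact (Nat.Prime 173)] (k : ℕ) :
    ¬ ∀ N : ℕ, 1 ≤ N → 0 ≤ iterSummatory (fun n ↦
      ((quadraticChar (ZMod 173)).ringHomComp (Int.castRingHom ℂ) (n : ZMod 173)).re) k N := by
  refine feketePolya_hypothesis_fails_of_apply_primes _ ?_ ?_ ?_ ?_ ?_ k
  · rw [show (2 : ZMod 173) = ((2 : ℕ) : ZMod 173) from rfl, quadraticCharComplex_apply_natCast]
    norm_num
  · rw [show (3 : ZMod 173) = ((3 : ℕ) : ZMod 173) from rfl, quadraticCharComplex_apply_natCast]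
    norm_num
  · rw [show (5 : ZMod 173) = ((5 : ℕ) : ZMod 173) from rfl, quadraticCharComplex_apply_natCast]
    norm_num
  · rw [show (7 : ZMod 173) = ((7 : ℕ) : ZMod 173) from rfl, quadraticCharComplex_apply_natCast]
    norm_num
  · rw [show (11 : ZMod 173) = ((11 : ℕ) : ZMod 173) from rfl, quadraticCharComplex_apply_natCast]
    norm_num

/-- The character `(·/173)` is even (`173 ≡ 1 (mod 4)`), so this instance concerns the even half
of the technique. [folklore] -/
theorem quadraticChar_173_even [Fact (Nat.Prime 173)] :
    DirichletCharacter.Even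
      ((quadraticChar (ZMod 173)).ringHomComp (Int.castRingHom ℂ) : DirichletCharacter ℂ 173) := by
  have h : ((172 : ℕ) : ZMod 173) = -1 := by
    rw [show (172 : ℕ) = 173 - 1 from rfl, Nat.cast_sub (by norm_num), ZMod.natCast_self,
      Nat.cast_one, zero_sub]
  rw [DirichletCharacter.Even, ← h, quadraticCharComplex_apply_natCast]
  norm_num

/-! ## Louboutin 2003, Proposition 3 at order one: `S_1 ≥ 0 ⇒ L(1, χ) ≥ 1/2` -/

/-- **Quantitative order-one criterion**: if `χ ≠ χ₀` and `S_1(N, χ) ≥ 0` for all `N ≥ 1` then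
`Re L(σ, χ) ≥ 1 − 2^{−σ}` for every `σ > 0` — the first term of the series of non-negative terms
`L(σ, χ) = ∑ S_1(n)(n^{−σ} − (n+1)^{−σ})` (`LFunction_re_pos_of_summatory_nonneg` keeps only its
sign). [cite: Louboutin2003, Proposition 3] [cite: MontgomeryVaughan2007, §11.2.1 Exercise 7 (a)] -/
theorem one_sub_two_rpow_le_re_LFunction_of_summatory_nonneg {m : ℕ} [NeZero m]
    (ψ : DirichletCharacter ℂ m) (hψ : ψ ≠ 1)
    (hS : ∀ N : ℕ, 1 ≤ N → 0 ≤ summatory (fun n ↦ (ψ (n : ZMod m)).re) N)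
    {σ : ℝ} (hσ : 0 < σ) : 1 - (2 : ℝ) ^ (-σ) ≤ (ψ.LFunction (σ : ℂ)).re := by
  have hs : 0 < (σ : ℂ).re := by simpa using hσ
  have hsum := Literature.NumberTheory.LFunctions.DirichletAbel.summable_term ψ hψ hs
  rw [Literature.NumberTheory.LFunctions.DirichletAbel.LFunction_eq_abelSum ψ hψ hs,
    Literature.NumberTheory.LFunctions.DirichletAbel.abelSum, Complex.re_tsum hsum]
  have hre : Summable fun n : ℕ ↦ (Literature.NumberTheory.LFunctions.DirichletAbel.term ψ n σ).re :=
    (Complex.hasSum_re hsum.hasSum).summable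
  have hnn : ∀ n : ℕ, 0 ≤ (Literature.NumberTheory.LFunctions.DirichletAbel.term ψ n σ).re :=
    fun n ↦ by
    rw [re_abelTerm_ofReal]
    exact mul_nonneg (hS (n + 1) (Nat.succ_pos n)) (rpow_neg_sub_rpow_neg_succ_pos n hσ).le
  have h0 : (Literature.NumberTheory.LFunctions.DirichletAbel.term ψ 0 σ).re = 1 - (2 : ℝ) ^ (-σ) := by
    rw [re_abelTerm_ofReal]
    have h1 : summatory (fun k ↦ (ψ (k : ZMod m)).re) (0 + 1) = 1 := by
      rw [summatory_succ, summatory_zero]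
      simp
    rw [h1, one_mul]
    norm_num
  rw [← h0]
  exact hre.le_tsum 0 fun n _ ↦ hnn n

/-- **Louboutin 2003, Proposition 3 (`m = 1`) / Chowla**: "If `S_χ^{(m)}(n) ≥ 0` for all `n ≥ 1`,
then `L(1, χ) ≥ 1 − ∑_{n=1}^{m} 1/(n+m)`" — at `m = 1`: `S_1 ≥ 0 ⇒ L(1, χ) ≥ 1/2`, for any
non-principal `χ`, primitive or not ("we do not assume that `χ` is primitive"). Contrapositive:
a real character with `L(1, χ) < 1/2` has a negative partial sum `S_1(N, χ)`.
[cite: Louboutin2003, Proposition 3] -/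
theorem half_le_re_LFunction_one_of_summatory_nonneg {m : ℕ} [NeZero m]
    (ψ : DirichletCharacter ℂ m) (hψ : ψ ≠ 1)
    (hS : ∀ N : ℕ, 1 ≤ N → 0 ≤ summatory (fun n ↦ (ψ (n : ZMod m)).re) N) :
    1 / 2 ≤ (ψ.LFunction 1).re := by
  have h := one_sub_two_rpow_le_re_LFunction_of_summatory_nonneg ψ hψ hS one_pos
  rw [Complex.ofReal_one] at h
  norm_num at h
  linarith

/-- **The constraint on Chowla's inducing modulus.** If `ψ ≠ χ₀` is a real character mod `d` and
the character `ψ↑q` it induces mod `q` (`d ∣ q`) has `S_1(N, ψ↑q) ≥ 0` for all `N ≥ 1`, then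
`Re L(1, ψ) · ∏_{p ∣ q} (1 − Re ψ(p)/p) ≥ 1/2` (`L(1, ψ↑q) = L(1, ψ) ∏_{p ∣ q}(1 − ψ(p) p^{−1})`,
`re_LFunction_changeLevel_ofReal`). Since `L(1, ψ)` can be small (`π/√163 = 0.246…` for
`χ_{−163}`), the inducing modulus of Chowla's conjecture must carry enough primes with
`ψ(p) = −1` to at least double it: "`ψ(d) > 0.373043 √163/π = 1.516012`… In particular `d` cannot
be a prime number". [cite: Louboutin2003, Proposition 3] [cite: Louboutin2013Chowla, §7.1] -/
theorem half_le_re_LFunction_one_mul_eulerFactors_of_induced {d q : ℕ} [NeZero d] [NeZero q]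
    (h : d ∣ q) (ψ : DirichletCharacter ℂ d) (hψ : ψ ≠ 1) (hψq : ψ ^ 2 = 1)
    (hS : ∀ N : ℕ, 1 ≤ N →
      0 ≤ summatory (fun n ↦ (DirichletCharacter.changeLevel h ψ (n : ZMod q)).re) N) :
    1 / 2 ≤ (ψ.LFunction 1).re *
      ∏ p ∈ q.primeFactors, (1 - (ψ (p : ZMod d)).re * (p : ℝ) ^ (-(1 : ℝ))) := by
  have h1 : DirichletCharacter.changeLevel h ψ ≠ 1 := fun h' ↦
    hψ ((DirichletCharacter.changeLevel_eq_one_iff h).mp h')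
  have hb := half_le_re_LFunction_one_of_summatory_nonneg _ h1 hS
  have hcl := re_LFunction_changeLevel_ofReal h ψ hψ hψq 1
  rw [Complex.ofReal_one] at hcl
  rwa [hcl] at hb

/-! ## The theta kernel at `d = −163` -/

/-- The terms `n χ_{−163}(n) (49/50)^{n²}` are summable (comparison with `n (49/50)ⁿ`). [folklore] -/
theorem summable_theta_chi163 :
    Summable fun n : ℕ ↦ (n : ℝ) * chi163 n * (49 / 50 : ℝ) ^ (n ^ 2) := by
  have hg : Summable fun n : ℕ ↦ ((n : ℝ) ^ 1 : ℝ) * (49 / 50 : ℝ) ^ n :=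
    summable_pow_mul_geometric_of_norm_lt_one 1 (by norm_num)
  refine Summable.of_norm_bounded hg (fun n ↦ ?_)
  rw [Real.norm_eq_abs, abs_mul, abs_mul, pow_one, Nat.abs_cast, abs_pow,
    abs_of_pos (by norm_num : (0 : ℝ) < 49 / 50)]
  have hq : (49 / 50 : ℝ) ^ (n ^ 2) ≤ (49 / 50 : ℝ) ^ n :=
    pow_le_pow_of_le_one (by norm_num) (by norm_num) (Nat.le_self_pow two_ne_zero n)
  calc (n : ℝ) * |chi163 n| * (49 / 50 : ℝ) ^ (n ^ 2) ≤ (n : ℝ) * 1 * (49 / 50 : ℝ) ^ n :=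
        mul_le_mul (mul_le_mul_of_nonneg_left (abs_chi163_le n) (Nat.cast_nonneg n)) hq
          (by positivity) (by positivity)
    _ = n * (49 / 50 : ℝ) ^ n := by rw [mul_one]

set_option exponentiation.threshold 1000 in
/-- Head of the theta series: `∑_{n ≤ 30} n (n/163) (49/50)^{n²} ≤ −3.9` (exactly `−3.9174…`; the
Legendre symbols `(n/163)`, `n ≤ 30`, are `λ(n)`). [folklore] -/
theorem sum_range_31_theta_chi163 :
    ∑ n ∈ range 31, (n : ℝ) * chi163 n * (49 / 50 : ℝ) ^ (n ^ 2) ≤ -39 / 10 := by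
  simp only [Finset.sum_range_succ, Finset.sum_range_zero, chi163]
  norm_num

/-- Tail of the theta series, abstractly in `r = (49/50)^{31}`: since `(n+31)² ≥ 31(n+31)`,
`∑_{n ≥ 31} n χ(n) (49/50)^{n²} ≤ ∑_{n ≥ 31} n rⁿ ≤ ∑_{n ≥ 0} n rⁿ = r/(1 − r)²`. [folklore] -/
theorem tsum_theta_tail_le_of_eq (r : ℝ) (hr : (49 / 50 : ℝ) ^ 31 = r) (hr0 : 0 ≤ r)
    (hr1 : r < 1) :
    ∑' n : ℕ, ((n + 31 : ℕ) : ℝ) * chi163 (n + 31) * (49 / 50 : ℝ) ^ ((n + 31) ^ 2) ≤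
      r / (1 - r) ^ 2 := by
  have hrn : ‖r‖ < 1 := by rwa [Real.norm_of_nonneg hr0]
  have hgeo := hasSum_coe_mul_geometric_of_norm_lt_one hrn
  have hsum : Summable fun n : ℕ ↦ (n : ℝ) * r ^ n := hgeo.summable
  have hle : ∀ n : ℕ, ((n + 31 : ℕ) : ℝ) * chi163 (n + 31) * (49 / 50 : ℝ) ^ ((n + 31) ^ 2) ≤
      ((n + 31 : ℕ) : ℝ) * r ^ (n + 31) := by
    intro n
    have hexp : 31 * (n + 31) ≤ (n + 31) ^ 2 := by
      rw [sq]; exact Nat.mul_le_mul_right _ (by omega)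
    have hpow : (49 / 50 : ℝ) ^ ((n + 31) ^ 2) ≤ r ^ (n + 31) := by
      rw [← hr, ← pow_mul]
      exact pow_le_pow_of_le_one (by norm_num) (by norm_num) hexp
    have hchi : chi163 (n + 31) ≤ 1 := le_of_abs_le (abs_chi163_le _)
    have hq0 : 0 ≤ (49 / 50 : ℝ) ^ ((n + 31) ^ 2) := pow_nonneg (by norm_num) _
    have h1 : chi163 (n + 31) * (49 / 50 : ℝ) ^ ((n + 31) ^ 2) ≤ r ^ (n + 31) :=
      calc chi163 (n + 31) * (49 / 50 : ℝ) ^ ((n + 31) ^ 2)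
          ≤ 1 * (49 / 50 : ℝ) ^ ((n + 31) ^ 2) := mul_le_mul_of_nonneg_right hchi hq0
        _ = (49 / 50 : ℝ) ^ ((n + 31) ^ 2) := one_mul _
        _ ≤ r ^ (n + 31) := hpow
    have hn0 : (0 : ℝ) ≤ ((n + 31 : ℕ) : ℝ) := Nat.cast_nonneg _
    calc ((n + 31 : ℕ) : ℝ) * chi163 (n + 31) * (49 / 50 : ℝ) ^ ((n + 31) ^ 2)
        = ((n + 31 : ℕ) : ℝ) * (chi163 (n + 31) * (49 / 50 : ℝ) ^ ((n + 31) ^ 2)) :=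
          mul_assoc _ _ _
      _ ≤ ((n + 31 : ℕ) : ℝ) * r ^ (n + 31) := mul_le_mul_of_nonneg_left h1 hn0
  have htail : Summable fun n : ℕ ↦ ((n + 31 : ℕ) : ℝ) * r ^ (n + 31) :=
    (summable_nat_add_iff (f := fun m : ℕ ↦ (m : ℝ) * r ^ m) 31).2 hsum
  have hhead : Summable fun n : ℕ ↦
      ((n + 31 : ℕ) : ℝ) * chi163 (n + 31) * (49 / 50 : ℝ) ^ ((n + 31) ^ 2) :=
    (summable_nat_add_iff (f := fun m : ℕ ↦ (m : ℝ) * chi163 m * (49 / 50 : ℝ) ^ (m ^ 2)) 31).2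
      summable_theta_chi163
  have hshift : ∑' n : ℕ, ((n + 31 : ℕ) : ℝ) * r ^ (n + 31) ≤ r / (1 - r) ^ 2 := by
    rw [← hgeo.tsum_eq, ← hsum.sum_add_tsum_nat_add 31]
    have : 0 ≤ ∑ n ∈ range 31, (n : ℝ) * r ^ n :=
      Finset.sum_nonneg fun n _ ↦ by positivity
    linarith
  exact (Summable.tsum_le_tsum hle hhead htail).trans hshift

/-- Tail of the theta series: `∑_{n ≥ 31} n (n/163) (49/50)^{n²} ≤ r/(1 − r)² ≤ 5/2`,
`r = (49/50)^{31} = 0.534…`. [folklore] -/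
theorem tsum_theta_tail_le :
    ∑' n : ℕ, ((n + 31 : ℕ) : ℝ) * chi163 (n + 31) * (49 / 50 : ℝ) ^ ((n + 31) ^ 2) ≤ 5 / 2 := by
  have hnum : (49 / 50 : ℝ) ^ 31 / (1 - (49 / 50 : ℝ) ^ 31) ^ 2 ≤ 5 / 2 := by norm_num
  exact (tsum_theta_tail_le_of_eq _ rfl (by positivity) (by norm_num)).trans hnum

/-- **The theta series of `χ_{−163}` takes a negative value**:
`∑_{n ≥ 1} n (n/163) (49/50)^{n²} ≤ −3.9 + 2.5 < 0`. This is `θ₁(t₀, χ_{−163})`,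
`θ₁(t, χ) = ∑ n χ(n) e^{−π n² t/163}`, at `t₀ = (163/π) log(50/49) = 1.048…` (`thetaKernel_chi163_neg`).
[folklore] -/
theorem theta_chi163_neg : ∑' n : ℕ, (n : ℝ) * chi163 n * (49 / 50 : ℝ) ^ (n ^ 2) < 0 := by
  rw [← summable_theta_chi163.sum_add_tsum_nat_add 31]
  have h1 := sum_range_31_theta_chi163
  have h2 := tsum_theta_tail_le
  linarith

/-- **The theta kernel fails at `d = −163`.** The odd theta series
`θ₁(t, χ_{−163}) = ∑_{n ≥ 1} n χ_{−163}(n) e^{−π n² t/163}`, whose Mellin transform is the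
completed `L`-function `(163/π)^{(s+1)/2} Γ((s+1)/2) L(s, χ_{−163})` (so that `θ₁ ≥ 0` on
`(0, ∞)` would force `L(σ, χ_{−163}) > 0` on `(0, 1)`, the theta analogue of MV Exercise
11.2.1.7 (j)), is NEGATIVE at `t₀ = (163/π) log(50/49) = 1.048…`: there
`e^{−π n² t₀/163} = (49/50)^{n²}` and `theta_chi163_neg` applies. (Numerically `θ₁(t, χ_{−163}) < 0`
for `0.09 < t < 11`; for almost all fundamental `D` the theta function has `≫ log₂ D/log₄ D` real
zeros.) [cite: KlurmanLamzouriMunsch2024, Corollary 1.9] -/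
theorem thetaKernel_chi163_neg :
    ∑' n : ℕ, (n : ℝ) * chi163 n *
        Real.exp (-(Real.pi * (n : ℝ) ^ 2 / 163) * (163 * Real.log (50 / 49) / Real.pi)) < 0 := by
  have hexp : ∀ n : ℕ, Real.exp (-(Real.pi * (n : ℝ) ^ 2 / 163) * (163 * Real.log (50 / 49) / Real.pi))
      = (49 / 50 : ℝ) ^ (n ^ 2) := by
    intro n
    have hπ : Real.pi ≠ 0 := Real.pi_ne_zero
    have harg : -(Real.pi * (n : ℝ) ^ 2 / 163) * (163 * Real.log (50 / 49) / Real.pi) =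
        ((n ^ 2 : ℕ) : ℝ) * Real.log (49 / 50) := by
      have hlog : Real.log (50 / 49) = -Real.log (49 / 50) := by
        rw [← Real.log_inv]; norm_num
      rw [hlog]; push_cast; field_simp
    rw [harg, Real.exp_nat_mul, Real.exp_log (by norm_num)]
  simp_rw [hexp]
  exact theta_chi163_neg

end Literature.Barriers.RiemannHypothesis

end
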